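import Summits.QuantumFields.YangMills.Theorems.BalabanUVNodesN11NoExpansionDiagonalCoPH

/-!
# DAG node N11 — THE v1.7 SMEARING-FUNCTION SLOT `Phih` IS INERT: `SLaw₁₃CoPH` and `TLaw₁₃CoPH` (the 𝐒- and 𝐓-law predicates N11 consumes) DO NOT READ the
# history-indexed residual's `φ`-component — the §2 tower of record reads `bgI`, `bgMS` only (`rfl`), and the (2.23) action ∕ operand ∕ slot read no component
# of the residual at all (p540862 §1); so the INDEX-PARITY row C2 fold (`θ.rzAt p s := ⟨bgI, bgMS, θ.Phih p n s.Ω s.Λ⟩`, director-ym №187 (1)) is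
# semantically a no-op for every law and identity clause of the record

Cell `pub-ymgap`, YM-PLAN Track A (HUMAN RULING D-0062), seat `pub-ymgap-dag-n11-d` (g8; R134 fan-out seat N11 [B14], strategy s2), route `BalabanUVNodes`
rev 25, item K1⁷ `StabilityBAtRecordR13SepCoPH` = stmt-QuantumFields-20542 (helper, count-neutral).  [III] = [Balaban1988Convergent].
Over node00-def-T's FILE 27 `Node00/Record13CoPH` (p537939: §0a `HasSect2Form…ZS`, §0b `Stage13HParams`, `rzAt`, §1 `sLaw₁₃CoPH_iff` ∕ `tLaw₁₃CoPH_iff`) and this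
seat's `…NoExpansionDiagonalCoPH` (p540862 §1: `sect2Slot_congr_residual`).

WHY THIS FILE (located structural remark of g8's LANDED-2 line, made a kernel statement about N11's own predicates).  The v1.7 record types the §2 residual
serving a history as `θ.rzAt p s = ⟨(θ.Rz p.K).bgI, (θ.Rz p.K).bgMS, θ.Phih p n s.Ω s.Λ⟩` (C2 fold).  In the tree's §2 frame the smearing functions `φ_j` enter
ONLY the (2.23) action, where they cancel identically between `−A(1∕g_n²(·), U)` and the `β_j(g_{j−1})A(φ_j, U)` counterterms (r11's `wilsonLocal_add_E225`;
lit-balaban DESK PRINT-CHECK 2026-08-27: the same cancellation holds in print's (2.23)–(2.25)); the regular spaces of the law packages read `bgI`, `bgMS` through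
`frameI ∕ frameMS` only.  Hence (i) the §2 TOWER of record at `θ.rzAt p s` IS the tower at the torus residual `θ.Rz p.K` (`rfl`), so the law packages
`LawsRT ∕ LawsT` coincide; (ii) the identity clauses coincide by p540862.  Consequently `SLaw₁₃CoPH θ p j` and `TLaw₁₃CoPH θ p k` are EQUIVALENT to the same
predicates with the constant residual family `fun _ => θ.Rz p.K`, and two `Stage13HParams` differing ONLY in `Phih` have the same 𝐒-∕𝐓-laws.  For N11's consumers:
nothing about `Phih` needs pinning or porting; for the record's design: the C2 fold carries no information the laws can see (harmless; count-neutral).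

WHAT THIS FILE PROVES (0 `sorry`, 0 `def`, standard axioms).  `sect2TowerOfRecord_rzAt_eq` (`rfl`) · `hasSect2FormAEZS_rzAt_iff_const` ·
`hasSect2FormTAEZS_rzAt_iff_const` · ★ `sLaw₁₃CoPH_iff_const_residual` · ★ `tLaw₁₃CoPH_iff_const_residual` · ★★ `sLaw₁₃CoPH_iff_of_Phih` ∕ `tLaw₁₃CoPH_iff_of_Phih`
(the laws at `⟨θ.toStage13RParams, θ.Zh, Φ′⟩` ↔ at `θ`, every `Φ′`).

HONEST FRAMING.  Count-neutral kernel bookkeeping on def-T's v1.7 typing; a reading of the TREE's §2 frame (faithful to print per the desk check), not a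
defect claim and not a change request; nothing of Bałaban's asserted; N11 NOT discharged; K1⁷ NOT closed; counts unmoved (typed 28∕28 · discharged 5∕28).  One
finite four-torus programme at fixed `ε = L^{−K}`; NOT ℝ⁴, NOT OS, NOT a mass gap, NOT Clay.  Sources: [III] (2.23)–(2.25) pp.258–259, (2.34)–(2.42) p.261,
(2.18) p.257, Thm 1 p.262, remark p.262; [IV] (0.2)–(0.3) p.176.
-/

noncomputable section

open MeasureTheory
open scoped BigOperators Matrix.Norms.L2Operator

namespace Summit.QuantumFields.YangMills.Theorems.BalabanUVNodesN11ResidualPhiInert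

open Literature.MathematicalPhysics.QuantumFieldTheory.Balaban1983to89 T4Continuum Node00 Node00.Tk DagBinding
open B15DeterminingSets
open BalabanUVNodesN11NoExpansionDiagonalCoPH (sect2Slot_congr_residual)

variable {F : T4Family} {N : ℕ} [NeZero N]

section Inert

variable (θ : Stage13HParams F N) (p : B12.RunParams)

/-- **THE §2 TOWER OF RECORD AT THE HISTORY's RESIDUAL IS THE TOWER AT THE TORUS RESIDUAL** (`rfl`): `towerOfTerms` reads `bgI`, `bgMS` (through `frameI`, `frameMS`)
and never `φ`, and `θ.rzAt p s` shares `bgI`, `bgMS` with `θ.Rz p.K`. [cite: Balaban1988Convergent, (2.34)–(2.42) p.261 (bookkeeping)] -/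
theorem sect2TowerOfRecord_rzAt_eq {n : ℕ} (s : SeqOfRecord F θ.ν θ.τ9.M (gOfRecord₁₃ F N θ.toStage13Params p) p.K n)
    (t : Sect2.TermValues (F.P p.K) (MatA N) (FluctV N) θ.τ9.M) :
    sect2TowerOfRecord F N (FluctV N) p.K (settingOfRecord₁₃ F N θ.toStage13Params p) (θ.rzAt p s) s t =
      sect2TowerOfRecord F N (FluctV N) p.K (settingOfRecord₁₃ F N θ.toStage13Params p) (θ.Rz p.K) s t := rfl

/-- **THE REPAIRED §2 FORM AT INDEX `k` DOES NOT SEE `φ`**: over the history-indexed residual family `θ.rzAt p` it is EQUIVALENT to the same predicate over the constant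
family `fun _ => θ.Rz p.K` (laws: same tower, `rfl`; identity clauses: `sect2Slot_congr_residual`) — every weight family, background family, slot family.
[cite: Balaban1988Convergent, Thm 1 p.262, (2.18) p.257, (2.23)–(2.25) pp.258–259] -/
theorem hasSect2FormAEZS_rzAt_iff_const (k : ℕ)
    (W : SeqOfRecord F θ.ν θ.τ9.M (gOfRecord₁₃ F N θ.toStage13Params p) p.K k → TkWeights F N (FluctV N) p.K)
    (U : SeqOfRecord F θ.ν θ.τ9.M (gOfRecord₁₃ F N θ.toStage13Params p) p.K k → BgMap F N p.K)
    (slot : SeqOfRecord F θ.ν θ.τ9.M (gOfRecord₁₃ F N θ.toStage13Params p) p.K k → Density (F.P p.K) k (SU N)) :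
    HasSect2FormAEZS F N (FluctV N) p.K (settingOfRecord₁₃ F N θ.toStage13Params p) k (θ.rzAt p) W U slot ↔
      HasSect2FormAEZS F N (FluctV N) p.K (settingOfRecord₁₃ F N θ.toStage13Params p) k (fun _ => θ.Rz p.K) W U slot := by
  constructor
  · rintro ⟨t, Ek, hu, hs⟩
    refine ⟨t, Ek, hu, fun s => ⟨(hs s).1, ?_⟩⟩
    rcases (hs s).2 with h0 | hid
    · exact Or.inl h0
    · refine Or.inr (hid.mono fun V h hχ => ?_)
      rw [h hχ]
      exact congrFun (sect2Slot_congr_residual _ (θ.rzAt p s) (θ.Rz p.K) (W s) s (t s) (Ek s) (U s)) V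
  · rintro ⟨t, Ek, hu, hs⟩
    refine ⟨t, Ek, hu, fun s => ⟨(hs s).1, ?_⟩⟩
    rcases (hs s).2 with h0 | hid
    · exact Or.inl h0
    · refine Or.inr (hid.mono fun V h hχ => ?_)
      rw [h hχ]
      exact congrFun (sect2Slot_congr_residual _ (θ.Rz p.K) (θ.rzAt p s) (W s) s (t s) (Ek s) (U s)) V

/-- **… AND THE 𝐓-IMAGE FORM DOES NOT SEE `φ`** (same proof with the laws `LawsT`). [cite: Balaban1988Convergent, remark p.262, (3.25) p.270, (2.23)–(2.25) pp.258–259] -/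
theorem hasSect2FormTAEZS_rzAt_iff_const (k : ℕ)
    (W : SeqOfRecord F θ.ν θ.τ9.M (gOfRecord₁₃ F N θ.toStage13Params p) p.K (k + 1) → TkWeights F N (FluctV N) p.K)
    (U : SeqOfRecord F θ.ν θ.τ9.M (gOfRecord₁₃ F N θ.toStage13Params p) p.K (k + 1) → BgMap F N p.K)
    (slotT : SeqOfRecord F θ.ν θ.τ9.M (gOfRecord₁₃ F N θ.toStage13Params p) p.K (k + 1) → Density (F.P p.K) (k + 1) (SU N)) :
    HasSect2FormTAEZS F N (FluctV N) p.K (settingOfRecord₁₃ F N θ.toStage13Params p) k (θ.rzAt p) W U slotT ↔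
      HasSect2FormTAEZS F N (FluctV N) p.K (settingOfRecord₁₃ F N θ.toStage13Params p) k (fun _ => θ.Rz p.K) W U slotT := by
  constructor
  · rintro ⟨t, Ek, hu, hs⟩
    refine ⟨t, Ek, hu, fun s => ⟨(hs s).1, ?_⟩⟩
    rcases (hs s).2 with h0 | hid
    · exact Or.inl h0
    · refine Or.inr (hid.mono fun V h hχ => ?_)
      rw [h hχ]
      exact congrFun (sect2Slot_congr_residual _ (θ.rzAt p s) (θ.Rz p.K) (W s) s (t s) (Ek s) (U s)) V
  · rintro ⟨t, Ek, hu, hs⟩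
    refine ⟨t, Ek, hu, fun s => ⟨(hs s).1, ?_⟩⟩
    rcases (hs s).2 with h0 | hid
    · exact Or.inl h0
    · refine Or.inr (hid.mono fun V h hχ => ?_)
      rw [h hχ]
      exact congrFun (sect2Slot_congr_residual _ (θ.Rz p.K) (θ.rzAt p s) (W s) s (t s) (Ek s) (U s)) V

/-- **★ `SLaw₁₃CoPH θ p j` DOES NOT READ `Phih`**: it is the repaired §2 form of the post-𝐑 slot family at the CONSTANT torus residual `θ.Rz p.K`, over the history-indexed
weights `WtOfRecord₁₃H θ p`. [cite: Balaban1988Convergent, (2.18) p.257, Thm 1 p.262] -/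
theorem sLaw₁₃CoPH_iff_const_residual (j : ℕ) :
    SLaw₁₃CoPH F N θ p j ↔ HasSect2FormAEZS F N (FluctV N) p.K (settingOfRecord₁₃ F N θ.toStage13Params p) j (fun _ => θ.Rz p.K) (WtOfRecord₁₃H F N θ p)
      (UbgOfRecord₁₃CoP F N θ.toStage13Params p j)
      (slotsOfRecord F N θ.ν θ.τ9 (EOfRecord₁₃ F N θ.toStage13Params) (wOfRecord₉ F N θ.toStage9Params) θ.ppSel p
        (gOfRecord₁₃ F N θ.toStage13Params p) j) :=
  (sLaw₁₃CoPH_iff F N θ p j).trans (hasSect2FormAEZS_rzAt_iff_const θ p j _ _ _)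

/-- **★ `TLaw₁₃CoPH θ p k` DOES NOT READ `Phih`**: it is the repaired 𝐓-image form of the pre-𝐑 slot family at the CONSTANT torus residual `θ.Rz p.K`, over the
history-indexed weights `WtOfRecord₁₃H θ p`. [cite: Balaban1988Convergent, remark p.262, (3.25) p.270] -/
theorem tLaw₁₃CoPH_iff_const_residual (k : ℕ) :
    TLaw₁₃CoPH F N θ p k ↔ HasSect2FormTAEZS F N (FluctV N) p.K (settingOfRecord₁₃ F N θ.toStage13Params p) k (fun _ => θ.Rz p.K) (WtOfRecord₁₃H F N θ p)
      (UbgOfRecord₁₃CoP F N θ.toStage13Params p (k + 1))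
      (slotsTOfRecord F N θ.ν θ.τ9 (EOfRecord₁₃ F N θ.toStage13Params) (wOfRecord₉ F N θ.toStage9Params) θ.ppSel p
        (gOfRecord₁₃ F N θ.toStage13Params p) (k + 1)) :=
  (tLaw₁₃CoPH_iff F N θ p k).trans (hasSect2FormTAEZS_rzAt_iff_const θ p k _ _ _)

/-- **★★ TWO v1.7 PARAMETERS DIFFERING ONLY IN `Phih` HAVE THE SAME 𝐒-LAW** (every `Φ′`). [cite: Balaban1988Convergent, (2.18) p.257, Thm 1 p.262, (2.24)–(2.25) p.259] -/
theorem sLaw₁₃CoPH_iff_of_Phih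
    (Φ' : (q : B12.RunParams) → ℕ → (ℕ → Set (Site (F.P q.K) 0)) → (ℕ → Set (Site (F.P q.K) 0)) → (ℕ → Plaq (F.P q.K) 0 → ℝ)) (j : ℕ) :
    SLaw₁₃CoPH F N (⟨θ.toStage13RParams, θ.Zh, Φ'⟩ : Stage13HParams F N) p j ↔ SLaw₁₃CoPH F N θ p j :=
  (sLaw₁₃CoPH_iff_const_residual ⟨θ.toStage13RParams, θ.Zh, Φ'⟩ p j).trans (sLaw₁₃CoPH_iff_const_residual θ p j).symm

/-- **★★ TWO v1.7 PARAMETERS DIFFERING ONLY IN `Phih` HAVE THE SAME 𝐓-LAW** (every `Φ′`) — N11's conjunct of K1 does not read the C2-folded slot.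
[cite: Balaban1988Convergent, remark p.262, (3.25) p.270, (2.24)–(2.25) p.259] -/
theorem tLaw₁₃CoPH_iff_of_Phih
    (Φ' : (q : B12.RunParams) → ℕ → (ℕ → Set (Site (F.P q.K) 0)) → (ℕ → Set (Site (F.P q.K) 0)) → (ℕ → Plaq (F.P q.K) 0 → ℝ)) (k : ℕ) :
    TLaw₁₃CoPH F N (⟨θ.toStage13RParams, θ.Zh, Φ'⟩ : Stage13HParams F N) p k ↔ TLaw₁₃CoPH F N θ p k :=
  (tLaw₁₃CoPH_iff_const_residual ⟨θ.toStage13RParams, θ.Zh, Φ'⟩ p k).trans (tLaw₁₃CoPH_iff_const_residual θ p k).symm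

end Inert

end Summit.QuantumFields.YangMills.Theorems.BalabanUVNodesN11ResidualPhiInert

end
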